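import Literature.InformationTheory.QuantumCodes.SmallSetFlipLocality
import Literature.InformationTheory.QuantumCodes.QuantumExpanderSmallSetFlip
import Literature.InformationTheory.QuantumCodes.MinWeightDecodingClusters
import Literature.InformationTheory.QuantumCodes.AlphaClusterCountingBound
import HarnessLib

/-!
# Failure of the small-set-flip decoder forces a large connected `α`-subset of the error

Index of sources: `[cite: FawziGrospellierLeverrier2018]` = Fawzi–Grospellier–Leverrier, "Efficient decoding of
random errors for quantum expander codes", STOC 2018 / arXiv:1711.08351v2 — §3.3 (Def 13, Lemma 14, Prop 15,
proof of Thm 1 from Props 11, 12, 15 and Thm 17).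

qec PARTITION v2 row 04 (`prover-qec-type-04`), item 04.FGL1 (the threshold theorem for the small-set-flip
decoder), step 3 of 4: the GENERIC reduction "decoder fails ⇒ `α`-percolation event". For an arbitrary CSS-like
pair (syndrome matrix `Hs : C × Q`, generator matrix `Hg : R × Q`), a threshold `κ > 0`, a column bound
`|Hs v| ≤ w|v|`, and a graph `G` on the qubits in which any two qubits sharing a check of `Hs` or a generator of
`Hg` are adjacent (FGL's `𝒢`), we prove:

* `compIn G U q` — the connected component of `q` in `U` (vertices of `U` reachable inside `U`), with its API
  (`mem_compIn_self`, `compIn_subset`, `mem_compIn_of_adj` (components are closed), `compIn_eq_of_mem`,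
  `isGraphConnected_compIn`, `sum_indicator_compIn` (a vector supported in `U` is the sum of its restrictions)).
* `isAlphaSubset_compIn_of_run` (**Lemma 14**): along a complete valid run from `σ_X(E)` with flips inside `U ⊇ E`,
  every component `K` of `U` is a `κ/(κ+w)`-subset of `E` (`|K| ≤ |E ∩ K| + Σ_{Fᵢ ⊆ K}|Fᵢ| ≤ (1 + w/κ)|E ∩ K|`, the
  second step by Prop 12 (`SmallSetFlip.ssfRun_restrict`) and the run invariant `κ Σ|Fᵢ| ≤ |σ_K| ≤ w|E ∩ K|`).
* `hasAlphaCluster_of_not_mem_rowSpace` / `hasAlphaCluster_of_not_corrects` (**Prop 15 ⇒ proof of Thm 1, the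
  deterministic half**): if complete valid runs correct every error of weight `≤ t₀` (the adversarial radius,
  an INPUT here — for quantum expander codes it is Prop 11), then a run / small-set-flip decoder that FAILS on `E`
  exhibits a connected `κ/(κ+w)`-subset of `E` with more than `t₀` vertices: `HasAlphaCluster G (κ/(κ+w)) (⌊t₀⌋₊+1) E`
  ("E ∩ K is not corrected ⇒ |E ∩ K| > t₀ ⇒ |K| > t₀, and K is a connected α-subset of E").
* `sum_not_corrects_le_geometric`: hence, for a locally stochastic error weight `μ` of parameter `p` and a degree
  bound `Δ` of `G` with `2Δ²p^α < 1`, the failure probability is at most the `α`-percolation bound of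
  `AlphaClusterCountingBound` (`sum_hasAlphaCluster_le_geometric`, the crude Peierls form of FGL Thm 17).

All statements are PROVED; no definitions (the connected components of the support are built inside the proof of
`hasAlphaCluster_of_not_mem_rowSpace` as `U.filter (ReflTransGen …)`), no new named facts. The specialisation to quantum expander codes (degree of `𝒢`,
Prop 11 as the radius, the constants `p₀, C, C'`) is the separate file `QuantumExpanderThreshold`.
-/

namespace Literature.InformationTheory.QuantumCodes

namespace SmallSetFlip

open Finset Matrix Literature.Probability.LatticeModels

variable {Q C R : Type*} [Fintype Q] [Fintype C] [Fintype R] [DecidableEq Q] [DecidableEq C]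

/-! ### Flips, supports, and the size of a closed part of the support -/

section RunSupport

omit [DecidableEq C] in
/-- Every flip of a complete valid run is a small set. [cite: FawziGrospellierLeverrier2018, Algorithm 1 (Fᵢ ∈ 𝓕)] -/
theorem mem_smallSets_of_isSSFRun {κ : ℝ} {Hs : Matrix C Q (ZMod 2)} {Hg : Matrix R Q (ZMod 2)}
    {σ : C → ZMod 2} {l : List (Finset Q)} (h : IsSSFRun κ Hs Hg σ l) : ∀ F ∈ l, F ∈ smallSets Hg := by
  induction h with
  | halt _ => intro F hF; simp at hF
  | step hF _ ih =>
    intro F' hF'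
    rcases List.mem_cons.1 hF' with rfl | h
    · exact hF.1
    · exact ih F' h

omit [Fintype Q] [Fintype C] [Fintype R] [DecidableEq C] in
/-- A qubit in the support of a run's output was flipped by some step.
[cite: FawziGrospellierLeverrier2018, Prop 12 ("U = E ∪ F₀ ∪ ⋯ ∪ F_{f-1}" is the support; arXiv v2 p0011)] -/
theorem exists_mem_of_runOutput_ne_zero (l : List (Finset Q)) {q : Q} (hq : runOutput l q ≠ 0) :
    ∃ F ∈ l, q ∈ F := by
  induction l with
  | nil => simp [runOutput] at hq
  | cons F l ih =>
    rw [QuantumExpander.runOutput_cons] at hq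
    by_cases hqF : q ∈ F
    · exact ⟨F, List.mem_cons_self, hqF⟩
    · have h' : runOutput l q ≠ 0 := by
        simpa [Pi.add_apply, flipVec, hqF] using hq
      obtain ⟨F', hF', hqF'⟩ := ih h'
      exact ⟨F', List.mem_cons_of_mem _ hF', hqF'⟩

omit [Fintype Q] in
/-- `|⋃ᵢ Fᵢ| ≤ Σᵢ |Fᵢ|` for a list of finite sets. [folklore] -/
private theorem card_biUnion_toFinset_le (L : List (Finset Q)) :
    ((L.toFinset).biUnion id).card ≤ (L.map Finset.card).sum := by
  induction L with
  | nil => simp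
  | cons F L ih =>
    rw [List.toFinset_cons, Finset.biUnion_insert, List.map_cons, List.sum_cons]
    exact (Finset.card_union_le _ _).trans (Nat.add_le_add_left ih _)

/-- **Size of a closed part of the support**: if `K ⊆ U` is closed under "shares a generator with a vertex of `U`",
the flips `Fᵢ ⊆ U` are small sets and `U ⊆ E ∪ ⋃Fᵢ`, then `|K| ≤ |E ∩ K| + Σ_{Fᵢ ⊆ K} |Fᵢ|` — every vertex of `K`
is an error qubit or lies in a flip, and a flip meeting `K` lies inside `K` (it is part of ONE generator).
[cite: FawziGrospellierLeverrier2018, Lemma 14 proof ("|K| ≤ |E ∩ K| + Σ_{i : Fᵢ ⊆ K} |Fᵢ|"; arXiv v2 p0012 L26-30)] -/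
theorem card_le_of_closed_run {Hg : Matrix R Q (ZMod 2)} {l : List (Finset Q)}
    (hsmall : ∀ F ∈ l, F ∈ smallSets Hg) {E U K : Finset Q} (hKU : K ⊆ U)
    (hKZ : ∀ q ∈ K, ∀ q' ∈ U, ∀ g, Hg g q ≠ 0 → Hg g q' ≠ 0 → q' ∈ K)
    (hl : ∀ F ∈ l, F ⊆ U) (hU : ∀ q ∈ U, q ∈ E ∨ ∃ F ∈ l, q ∈ F) :
    K.card ≤ (E ∩ K).card + ((l.filter fun F => decide (F ⊆ K)).map Finset.card).sum := by
  classical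
  have hcover : K ⊆ (E ∩ K) ∪ ((l.filter fun F => decide (F ⊆ K)).toFinset.biUnion id) := by
    intro q hq
    rw [Finset.mem_union]
    rcases hU q (hKU hq) with hqE | ⟨F, hFl, hqF⟩
    · exact Or.inl (Finset.mem_inter.2 ⟨hqE, hq⟩)
    · right
      have hFK : F ⊆ K := by
        obtain ⟨g, hg⟩ := exists_subset_genSupport_of_mem_smallSets (hsmall F hFl)
        intro q' hq'
        exact hKZ q hq q' (hl F hFl hq') g (Finset.mem_filter.1 (hg hqF)).2 (Finset.mem_filter.1 (hg hq')).2
      rw [Finset.mem_biUnion]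
      refine ⟨F, ?_, hqF⟩
      rw [List.mem_toFinset, List.mem_filter]
      exact ⟨hFl, by simpa using hFK⟩
  calc K.card ≤ ((E ∩ K) ∪ ((l.filter fun F => decide (F ⊆ K)).toFinset.biUnion id)).card :=
        Finset.card_le_card hcover
    _ ≤ (E ∩ K).card + ((l.filter fun F => decide (F ⊆ K)).toFinset.biUnion id).card :=
        Finset.card_union_le _ _
    _ ≤ (E ∩ K).card + ((l.filter fun F => decide (F ⊆ K)).map Finset.card).sum :=
        Nat.add_le_add_left (card_biUnion_toFinset_le _) _

/-- **Fawzi–Grospellier–Leverrier 2018, Lemma 14** (generic form): along a complete valid run of the small-set-flip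
decoder with threshold `κ > 0` from the syndrome `σ_X(E)`, flips inside `U ⊇ E`, `U ⊆ E ∪ ⋃ Fᵢ`, and a syndrome
matrix with `|Hs v| ≤ w|v|`, every part `K ⊆ U` closed under "shares a check / a generator with a vertex of `U`"
(e.g. a connected component of `U` in the graph `𝒢`) is an `α`-subset of `E` with `α = κ/(κ+w)` (`= β₀/(1+β₀)` for
`κ = β₀Δ_B`, `w = Δ_B`, using `Δ_A ≤ Δ_B`): by Prop 12 the sub-run inside `K` is a valid run from `σ_X(E ∩ K)`, so
`κ Σ_{Fᵢ ⊆ K}|Fᵢ| ≤ |σ_X(E ∩ K)| ≤ w|E ∩ K|`, and `|K| ≤ |E ∩ K| + Σ_{Fᵢ ⊆ K}|Fᵢ| ≤ (1 + w/κ)|E ∩ K|`.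
[cite: FawziGrospellierLeverrier2018, Lemma 14 and its proof (§3.3, arXiv v2 p0012 L18-33)] -/
theorem isAlphaSubset_of_closed_run {Hs : Matrix C Q (ZMod 2)} {Hg : Matrix R Q (ZMod 2)}
    {κ w : ℝ} (hκ : 0 < κ) (hw0 : 0 ≤ w)
    (hw : ∀ v : Q → ZMod 2, (hammingNorm (Hs *ᵥ v) : ℝ) ≤ w * hammingNorm v)
    {E : Finset Q} {l : List (Finset Q)} (hrun : IsSSFRun κ Hs Hg (Hs *ᵥ flipVec E) l)
    {U K : Finset Q} (hEU : E ⊆ U) (hKU : K ⊆ U)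
    (hKX : ∀ q ∈ K, ∀ q' ∈ U, ∀ c, Hs c q ≠ 0 → Hs c q' ≠ 0 → q' ∈ K)
    (hKZ : ∀ q ∈ K, ∀ q' ∈ U, ∀ g, Hg g q ≠ 0 → Hg g q' ≠ 0 → q' ∈ K)
    (hl : ∀ F ∈ l, F ⊆ U) (hU : ∀ q ∈ U, q ∈ E ∨ ∃ F ∈ l, q ∈ F) :
    IsAlphaSubset (κ / (κ + w)) E K := by
  classical
  obtain ⟨hrunK, -⟩ := ssfRun_restrict U K hKX hKZ hrun hl
  rw [indicator_mulVec_flipVec_eq Hs U K E hKX hEU] at hrunK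
  obtain ⟨-, hinv⟩ := QuantumExpander.ssfRun_invariants hrunK
  have hσ : (hammingNorm (Hs *ᵥ flipVec (E ∩ K)) : ℝ) ≤ w * ((E ∩ K).card : ℝ) := by
    have h := hw (flipVec (E ∩ K))
    rwa [QuantumExpander.hammingNorm_flipVec] at h
  have hsum : κ * (((l.filter fun F => decide (F ⊆ K)).map Finset.card).sum : ℝ) ≤ w * (E ∩ K).card := by
    have h0 : (0 : ℝ) ≤ hammingNorm (Hs *ᵥ flipVec (E ∩ K)
        + Hs *ᵥ runOutput (l.filter fun F => decide (F ⊆ K))) := Nat.cast_nonneg _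
    linarith
  have hcard : (K.card : ℝ) ≤ (E ∩ K).card + (((l.filter fun F => decide (F ⊆ K)).map Finset.card).sum : ℝ) := by
    have h := card_le_of_closed_run (mem_smallSets_of_isSSFRun hrun) (E := E) hKU hKZ hl hU
    exact_mod_cast h
  unfold IsAlphaSubset
  rw [Finset.inter_comm K E]
  have hκw : 0 < κ + w := by linarith
  rw [div_mul_eq_mul_div, div_le_iff₀ hκw]
  have h1 : κ * (K.card : ℝ)
      ≤ κ * (E ∩ K).card + κ * (((l.filter fun F => decide (F ⊆ K)).map Finset.card).sum : ℝ) := by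
    rw [← mul_add]; exact mul_le_mul_of_nonneg_left hcard hκ.le
  have h2 : ((E ∩ K).card : ℝ) * (κ + w) = κ * (E ∩ K).card + w * (E ∩ K).card := by ring
  rw [h2]
  linarith

end RunSupport

/-! ### Failure forces a large connected `α`-subset -/

section Failure

variable {G : SimpleGraph Q}

/-- **Fawzi–Grospellier–Leverrier 2018, Prop 15 ⇒ Thm 1 (deterministic half)**, run form, for a graph `G` on the
qubits in which two distinct qubits sharing a check of `Hs` or a generator of `Hg` are adjacent (FGL's `𝒢`):
suppose complete valid runs (threshold `κ`) correct every `X`-error of weight `≤ t₀` (the adversarial radius —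
Prop 11 for quantum expander codes). If a complete valid run from `σ_X(E)` FAILS (`E ⊕ Ê ∉ C_Z^⊥`), then `E` has a
connected `κ/(κ+w)`-subset with more than `t₀` vertices: writing `E ⊕ Ê = ⊎_K (E ⊕ Ê) ∩ K` over the connected
components `K` of the support `U = E ∪ ⋃Fᵢ` (the sets `U.filter (ReflTransGen …)`), some
`(E ⊕ Ê) ∩ K = (E ∩ K) ⊕ Ê_K` is not in `C_Z^⊥`; by Prop 12, `Ê_K` is the output of a valid run on `σ_X(E ∩ K)`,
so `|E ∩ K| > t₀`, whence `|K| ≥ |E ∩ K| ≥ ⌊t₀⌋ + 1`; and `K` is connected and an `α`-subset (Lemma 14).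
[cite: FawziGrospellierLeverrier2018, Prop 15 and the proof of Thm 1 (§3.3, arXiv v2 p0012 L35-60)] -/
theorem hasAlphaCluster_of_not_mem_rowSpace {Hs : Matrix C Q (ZMod 2)} {Hg : Matrix R Q (ZMod 2)}
    (hGX : ∀ c q q', q ≠ q' → Hs c q ≠ 0 → Hs c q' ≠ 0 → G.Adj q q')
    (hGZ : ∀ g q q', q ≠ q' → Hg g q ≠ 0 → Hg g q' ≠ 0 → G.Adj q q')
    {κ w : ℝ} (hκ : 0 < κ) (hw0 : 0 ≤ w)
    (hw : ∀ v : Q → ZMod 2, (hammingNorm (Hs *ᵥ v) : ℝ) ≤ w * hammingNorm v)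
    {t₀ : ℝ} (ht₀ : 0 ≤ t₀)
    (hcorr : ∀ (E' : Finset Q) (l' : List (Finset Q)), IsSSFRun κ Hs Hg (Hs *ᵥ flipVec E') l' →
      ((E'.card : ℝ) ≤ t₀) → flipVec E' + runOutput l' ∈ rowSpace Hg)
    {E : Finset Q} {l : List (Finset Q)} (hrun : IsSSFRun κ Hs Hg (Hs *ᵥ flipVec E) l)
    (hfail : flipVec E + runOutput l ∉ rowSpace Hg) :
    HasAlphaCluster G (κ / (κ + w)) (⌊t₀⌋₊ + 1) E := by
  classical
  -- the support `U = E ∪ ⋃ Fᵢ`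
  set U : Finset Q := E ∪ l.toFinset.biUnion id with hUdef
  have hEU : E ⊆ U := Finset.subset_union_left
  have hl : ∀ F ∈ l, F ⊆ U := fun F hF q hq =>
    Finset.mem_union_right _ (Finset.mem_biUnion.2 ⟨F, List.mem_toFinset.2 hF, hq⟩)
  have hU : ∀ q ∈ U, q ∈ E ∨ ∃ F ∈ l, q ∈ F := by
    intro q hq
    rcases Finset.mem_union.1 hq with h | h
    · exact Or.inl h
    · obtain ⟨F, hF, hqF⟩ := Finset.mem_biUnion.1 h
      exact Or.inr ⟨F, List.mem_toFinset.1 hF, hqF⟩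
  -- connected components of `U` in `G`: `comp q` = the vertices of `U` reachable from `q` inside `U`
  set r : Q → Q → Prop := fun x y => G.Adj x y ∧ x ∈ U ∧ y ∈ U with hrdef
  set comp : Q → Finset Q := fun q => U.filter fun q' => Relation.ReflTransGen r q q' with hcompdef
  have mem_comp : ∀ {q q' : Q}, q' ∈ comp q ↔ q' ∈ U ∧ Relation.ReflTransGen r q q' := by
    intro q q'
    simp only [hcompdef, Finset.mem_filter]
  have comp_subset : ∀ q, comp q ⊆ U := fun q q' hq' => (mem_comp.1 hq').1
  have self_mem : ∀ {q}, q ∈ U → q ∈ comp q := fun hq => mem_comp.2 ⟨hq, Relation.ReflTransGen.refl⟩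
  have closed : ∀ {q x y : Q}, x ∈ comp q → y ∈ U → G.Adj x y → y ∈ comp q := by
    intro q x y hx hy hxy
    rw [mem_comp] at hx ⊢
    exact ⟨hy, hx.2.tail ⟨hxy, hx.1, hy⟩⟩
  have rsymm : ∀ {a b : Q}, Relation.ReflTransGen r a b → Relation.ReflTransGen r b a := by
    intro a b hab
    haveI : Std.Symm r := ⟨fun x y hxy => ⟨hxy.1.symm, hxy.2.2, hxy.2.1⟩⟩
    exact Std.Symm.symm _ _ hab
  have comp_eq : ∀ {q q' : Q}, q' ∈ comp q → comp q' = comp q := by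
    intro q q' h
    rw [mem_comp] at h
    ext z
    rw [mem_comp, mem_comp]
    constructor
    · rintro ⟨hz, hqz⟩; exact ⟨hz, h.2.trans hqz⟩
    · rintro ⟨hz, hqz⟩; exact ⟨hz, (rsymm h.2).trans hqz⟩
  have conn : ∀ {q}, q ∈ U → IsGraphConnected G (comp q) := by
    intro q hq
    rw [isGraphConnected_iff_reflTransGen (hv := self_mem hq)]
    intro z hz
    rw [mem_comp] at hz
    -- a path inside `U` from `q` stays inside the component
    have key : ∀ z, Relation.ReflTransGen r q z →
        Relation.ReflTransGen (fun x y => G.Adj x y ∧ x ∈ comp q ∧ y ∈ comp q) q z := by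
      intro z hz
      induction hz with
      | refl => exact Relation.ReflTransGen.refl
      | @tail s t hs hst ih =>
        have hs' : s ∈ comp q := mem_comp.2 ⟨hst.2.1, hs⟩
        exact ih.tail ⟨hst.1, hs', closed hs' hst.2.2 hst.1⟩
    exact key z hz.2
  -- closure of components under the decoder's moves (the hypotheses of Prop 12)
  have closedX : ∀ q₀, ∀ q ∈ comp q₀, ∀ q' ∈ U, ∀ c, Hs c q ≠ 0 → Hs c q' ≠ 0 → q' ∈ comp q₀ := by
    intro q₀ q hq q' hq' c h1 h2
    by_cases hqq : q = q'
    · exact hqq ▸ hq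
    · exact closed hq hq' (hGX c q q' hqq h1 h2)
  have closedZ : ∀ q₀, ∀ q ∈ comp q₀, ∀ q' ∈ U, ∀ g, Hg g q ≠ 0 → Hg g q' ≠ 0 → q' ∈ comp q₀ := by
    intro q₀ q hq q' hq' g h1 h2
    by_cases hqq : q = q'
    · exact hqq ▸ hq
    · exact closed hq hq' (hGZ g q q' hqq h1 h2)
  -- the final error `E ⊕ Ê` is supported in `U` …
  set v : Q → ZMod 2 := flipVec E + runOutput l with hvdef
  have hv : ∀ q, v q ≠ 0 → q ∈ U := by
    intro q hq
    by_contra hqU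
    apply hq
    have h1 : flipVec E q = 0 := by
      simp only [flipVec, ite_eq_right_iff, one_ne_zero, imp_false]
      exact fun hqE => hqU (hEU hqE)
    have h2 : runOutput l q = 0 := by
      by_contra h
      obtain ⟨F, hF, hqF⟩ := exists_mem_of_runOutput_ne_zero l h
      exact hqU (hl F hF hqF)
    rw [hvdef, Pi.add_apply, h1, h2, add_zero]
  -- … and is the sum of its restrictions to the components
  have hdecomp : ∑ K ∈ U.image comp, Set.indicator (K : Set Q) v = v := by
    ext q
    rw [Finset.sum_apply]
    by_cases hq : q ∈ U
    · rw [Finset.sum_eq_single (comp q)]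
      · rw [Set.indicator_of_mem (by exact_mod_cast self_mem hq)]
      · intro K hK hne
        obtain ⟨q', -, rfl⟩ := Finset.mem_image.1 hK
        rw [Set.indicator_of_notMem]
        intro hqK
        have hqK' : q ∈ comp q' := by exact_mod_cast hqK
        exact hne (comp_eq hqK').symm
      · intro h
        exact absurd (Finset.mem_image.2 ⟨q, hq, rfl⟩) h
    · have hvq : v q = 0 := by by_contra h; exact hq (hv q h)
      rw [hvq]
      refine Finset.sum_eq_zero fun K hK => ?_
      obtain ⟨q', -, rfl⟩ := Finset.mem_image.1 hK
      rw [Set.indicator_of_notMem]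
      intro h
      exact hq (comp_subset q' (by exact_mod_cast h))
  -- some component carries a part of `E ⊕ Ê` outside `C_Z^⊥`
  have hbad : ∃ q₀ ∈ U, Set.indicator (comp q₀ : Set Q) v ∉ rowSpace Hg := by
    by_contra hall
    push Not at hall
    apply hfail
    rw [← hdecomp]
    refine Submodule.sum_mem _ fun K hK => ?_
    obtain ⟨q₀, hq₀, rfl⟩ := Finset.mem_image.1 hK
    exact hall q₀ hq₀
  obtain ⟨q₀, hq₀, hbadK⟩ := hbad
  set K := comp q₀ with hKdef
  have hKU : K ⊆ U := comp_subset q₀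
  have hKX := closedX q₀
  have hKZ := closedZ q₀
  obtain ⟨hrunK, houtK⟩ := ssfRun_restrict U K hKX hKZ hrun hl
  rw [indicator_mulVec_flipVec_eq Hs U K E hKX hEU] at hrunK
  have hind : Set.indicator (K : Set Q) v = flipVec (E ∩ K) + runOutput (l.filter fun F => decide (F ⊆ K)) := by
    rw [houtK, hvdef]
    ext q
    simp only [Set.indicator_apply, Finset.mem_coe, Pi.add_apply, flipVec, Finset.mem_inter]
    by_cases hqK : q ∈ K <;> by_cases hqE : q ∈ E <;> simp [hqK, hqE]
  rw [hind] at hbadK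
  -- hence `|E ∩ K| > t₀`
  have hbig : t₀ < ((E ∩ K).card : ℝ) := by
    by_contra hle
    push Not at hle
    exact hbadK (hcorr (E ∩ K) _ hrunK hle)
  have ht : ⌊t₀⌋₊ + 1 ≤ K.card := by
    have h1 : ⌊t₀⌋₊ < (E ∩ K).card := (Nat.floor_lt ht₀).2 hbig
    have h2 : (E ∩ K).card ≤ K.card := Finset.card_le_card Finset.inter_subset_right
    omega
  exact ⟨K, conn hq₀, ht, isAlphaSubset_of_closed_run hκ hw0 hw hrun hEU hKU hKX hKZ hl hU⟩

/-- **Decoder form** of the previous theorem: a small-set-flip DECODER (threshold `κ`, any tie-breaking) that fails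
on the error pattern `E` exhibits the `α`-percolation event `MaxConn_α(E) ≥ ⌊t₀⌋ + 1`.
[cite: FawziGrospellierLeverrier2018, proof of Thm 1 ("E is not corrected ⇒ MaxConn_α(E) > t₀"; arXiv v2 p0012 L55-60)] -/
theorem hasAlphaCluster_of_not_corrects {Hs : Matrix C Q (ZMod 2)} {Hg : Matrix R Q (ZMod 2)}
    (hGX : ∀ c q q', q ≠ q' → Hs c q ≠ 0 → Hs c q' ≠ 0 → G.Adj q q')
    (hGZ : ∀ g q q', q ≠ q' → Hg g q ≠ 0 → Hg g q' ≠ 0 → G.Adj q q')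
    {κ w : ℝ} (hκ : 0 < κ) (hw0 : 0 ≤ w)
    (hw : ∀ v : Q → ZMod 2, (hammingNorm (Hs *ᵥ v) : ℝ) ≤ w * hammingNorm v)
    {t₀ : ℝ} (ht₀ : 0 ≤ t₀)
    (hcorr : ∀ (E' : Finset Q) (l' : List (Finset Q)), IsSSFRun κ Hs Hg (Hs *ᵥ flipVec E') l' →
      ((E'.card : ℝ) ≤ t₀) → flipVec E' + runOutput l' ∈ rowSpace Hg)
    {D : Decoder (C → ZMod 2) (Q → ZMod 2)} (hD : IsSSFDecoder κ Hs Hg D) {E : Finset Q}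
    (hfail : ¬ D.Corrects (fun x => Hs *ᵥ x) (rowSpace Hg : Set _) (flipVec E)) :
    HasAlphaCluster G (κ / (κ + w)) (⌊t₀⌋₊ + 1) E := by
  obtain ⟨l, hrun, hDl⟩ := hD (Hs *ᵥ flipVec E)
  refine hasAlphaCluster_of_not_mem_rowSpace hGX hGZ hκ hw0 hw ht₀ hcorr hrun ?_
  intro hmem
  apply hfail
  rw [Decoder.Corrects, hDl, add_comm]
  exact hmem

open Classical in
/-- **Failure probability of a small-set-flip decoder ≤ the `α`-percolation bound** (generic assembly of FGL's
proof of Thm 1: Props 11/12/15 feed Thm 17 — here its crude Peierls form `sum_hasAlphaCluster_le_geometric`): for a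
locally stochastic error weight `μ` of parameter `p ∈ [0,1]`, a degree bound `Δ ≥ 1` of `G` and `2Δ²p^α < 1`,
`Σ_{E not corrected} μ(E) ≤ |Q| (2Δ²p^α)^{⌊t₀⌋+1} / (Δ²(1 − 2Δ²p^α))`.
[cite: FawziGrospellierLeverrier2018, proof of Thm 1 ("P[E not corrected] ≤ P[MaxConn_α(E) > t₀] ≤ …"; §3.3, arXiv v2 p0012 L55-62)] -/
theorem sum_not_corrects_le_geometric [DecidableRel G.Adj] {Hs : Matrix C Q (ZMod 2)} {Hg : Matrix R Q (ZMod 2)}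
    (hGX : ∀ c q q', q ≠ q' → Hs c q ≠ 0 → Hs c q' ≠ 0 → G.Adj q q')
    (hGZ : ∀ g q q', q ≠ q' → Hg g q ≠ 0 → Hg g q' ≠ 0 → G.Adj q q')
    {κ w : ℝ} (hκ : 0 < κ) (hw0 : 0 ≤ w)
    (hw : ∀ v : Q → ZMod 2, (hammingNorm (Hs *ᵥ v) : ℝ) ≤ w * hammingNorm v)
    {t₀ : ℝ} (ht₀ : 0 ≤ t₀)
    (hcorr : ∀ (E' : Finset Q) (l' : List (Finset Q)), IsSSFRun κ Hs Hg (Hs *ᵥ flipVec E') l' →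
      ((E'.card : ℝ) ≤ t₀) → flipVec E' + runOutput l' ∈ rowSpace Hg)
    {D : Decoder (C → ZMod 2) (Q → ZMod 2)} (hD : IsSSFDecoder κ Hs Hg D)
    {Δ : ℕ} (hΔ : ∀ x, G.degree x ≤ Δ) (hΔ1 : 1 ≤ Δ)
    {μ : Finset Q → ℝ} {p : ℝ} (hμ : IsLocallyStochastic μ p) (hp0 : 0 ≤ p) (hp1 : p ≤ 1)
    (hr : 2 * (Δ : ℝ) ^ 2 * p ^ (κ / (κ + w)) < 1) :
    ∑ E ∈ univ.filter (fun E : Finset Q => ¬ D.Corrects (fun x => Hs *ᵥ x) (rowSpace Hg : Set _) (flipVec E)), μ E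
      ≤ (Fintype.card Q : ℝ) * (2 * (Δ : ℝ) ^ 2 * p ^ (κ / (κ + w))) ^ (⌊t₀⌋₊ + 1) /
          ((Δ : ℝ) ^ 2 * (1 - 2 * (Δ : ℝ) ^ 2 * p ^ (κ / (κ + w)))) := by
  have hα : 0 < κ / (κ + w) := div_pos hκ (by linarith)
  refine le_trans ?_ (sum_hasAlphaCluster_le_geometric hΔ hΔ1 hμ hp0 hp1 hα (t := ⌊t₀⌋₊ + 1) (by omega) hr)
  refine Finset.sum_le_sum_of_subset_of_nonneg ?_ fun E _ _ => hμ.nonneg E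
  intro E hE
  rw [Finset.mem_filter] at hE ⊢
  exact ⟨hE.1, hasAlphaCluster_of_not_corrects hGX hGZ hκ hw0 hw ht₀ hcorr hD hE.2⟩

end Failure

end SmallSetFlip

end Literature.InformationTheory.QuantumCodes
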